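/-
Copyright (c) 2026 the pub-hodgecm-mathlib formalisation cell (harness21).  Prover seat hodgecm-mathlib-K2E2-p12 (g6): Track B «K2-LIT», ENGINE E1,
h413 = stmt-HodgeConjecture-24833; line `K2_E1_TraceFormulaBeta`, 5Res campaign «ENDGAME BY FAMILIES», deal (211) C8 = (FIN) of K2E1-plan (g7): ONLY FINITELY MANY SELF-DUAL HECKE
CHARACTERS OF A CM FIELD HAVE A PRESCRIBED LEVEL AND A PRESCRIBED RESTRICTION TO THE COMPACT ARCHIMEDEAN TORUS.
-/
import Summits.HodgeConjecture.HodgeConjecture.Theorems.K2E1IdeleClassCharactersFiniteOfType   -- ★ (K2E4-p23): `finite_setOf_heckeCharacter_arch_eq_level` (full arch component + level ⇒ finite)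
import Summits.HodgeConjecture.HodgeConjecture.Theorems.K2E1CharacterEisensteinU2Defs        -- ★ `reflectChar c χ` (χʷ(a) = χ(c a)⁻¹), `conjAdele`
import Literature.NumberTheory.Automorphic.RelNormOneTorusArch                              -- ★ `relNormOneInfUnits L⁺ L = {y ∈ L_∞ˣ : y ȳ = 1}`, `galSmul_infiniteIdeles` (+ ★ `ArchimedeanHerbrand`, `CMTypeHeckeCharacter`)
import HarnessLib

/-!
# K2·E1 — `K2E1SelfDualHeckeCharactersFiniteCMTwo` (deal (211), C8 = (FIN)): FOR A CM FIELD `L`, THE SELF-DUAL HECKE CHARACTERS (`χ·(χ∘c) = 1`, i.e. `χʷ = χ`) OF A FIXED FINITE LEVEL `U_f`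
# AND A FIXED RESTRICTION TO THE COMPACT TORUS `∏_w U(1) ⊆ L_∞ˣ` (e.g. circle exponents `m_w`) FORM A FINITE SET [Tate (Cassels–Fröhlich VII §5.1); Weil BNT IV §4 Thm. 6; MW V.3.13]

Track B ∕ K2-LIT, crux h413 = `stmt-HodgeConjecture-24833`, route of record `HCCMUnconditional`; cell `hodgecm-mathlib`, squad K2, ENGINE E1 (5Res campaign, ROADCARD «5Res ENDGAME BY
FAMILIES»: the residual families of `U(Φ₂)` are indexed by the self-associate cuspidal data `χ = χʷ` on the Borel Levi `T ≅ Res_{L∕L⁺} 𝔾_m` of a given `K_U`-type — C8 says there are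
FINITELY MANY of them).  THEOREMS ONLY (no `def`, no `instance`, no notation, no `sorry`; default heartbeats); lane `--supports stmt-HodgeConjecture-24833 --as helper` (count-neutral).

THE STATEMENT (CM print `finite_setOf_selfDual_heckeCharacter_cm`): `L` CM, `c` = complex conjugation, `U_f` an OPEN subgroup of the finite idele units (a level, e.g. a principal
congruence subgroup of an ideal `𝔫`), `Φ` ANY prescribed function on the compact archimedean torus `K_∞^T = relNormOneInfUnits L⁺ L = {y : y ȳ = 1} ≅ ∏_w U(1)` (e.g. the circle characters
`Φ(k) = ∏_w ι_w(k_w)^{m_w}` of fixed exponents `m : (w ∣ ∞) → ℤ`): the set of Hecke characters `χ` of `L` with (i) `χʷ = χ` (★ `reflectChar c χ = χ`, i.e. `χ(a)·χ(c a) = 1` — SELF-DUAL),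
(ii) `χ = 1` on the ideles with archimedean part `1` and finite part in `U_f` (LEVEL), (iii) `χ(ι_∞ k) = Φ k` on `K_∞^T` (ARCH TYPE ON THE CIRCLES) is FINITE.  UNITARITY IS NOT NEEDED.
THE PROOF (no character theory of `ℝ_{>0}`, no continuity argument): two such `χ, χ₀` differ by `ψ = χ χ₀⁻¹`, again self-dual, trivial on `ι_∞(K_∞^T)` and on the level ideles; every archimedean
idele is `a = k · q · q` with `k ∈ K_∞^T` and `q` POSITIVE REAL, hence FIXED by `c` (`exists_torus_mul_sq_fixed`: `q_w = √‖a_w‖` under `ι_w : L_w ≅ ℂ`, ★ `exists_extensionEmbedding_eq_ofReal`,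
★ `extensionEmbedding_infSMul`); self-duality at the fixed idele `ι_∞ q` reads `ψ(ι_∞ q)·ψ(ι_∞ q) = 1`, so `ψ(ι_∞ a) = ψ(ι_∞ k)·ψ(ι_∞ q)² = 1`: `ψ` has TRIVIAL archimedean component and level
`U_f`, and ★ `finite_setOf_heckeCharacter_arch_eq_level` (K2E4-p23: open subgroups of `C_L` have finite index) leaves finitely many `ψ`.
* §1 (generic `E∕F`, `c ∈ Aut(E∕F)`): `reflectChar_eq_self_iff`, `units_map_conjAdele_eq_smul`, and **`finite_setOf_heckeCharacter_selfDual_arch_level`** — HYPOTHESIS-FIRST on the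
  square-root property `hsq : ∀ a, ∃ k ∈ Kinf, ∃ q, c • ι_∞ q = ι_∞ q ∧ a = k * q * q` of an arbitrary arch set `Kinf`.
* §2 (CM) **`exists_torus_mul_sq_fixed`** — the square-root property for `Kinf = relNormOneInfUnits L⁺ L` and complex conjugation.
* §3 (CM print) **`finite_setOf_selfDual_heckeCharacter_cm`**.
HONEST LABEL: HC_CM is proved only modulo the 7 printed citations (2 remaining named inputs: hLiu418 = `stmt-HodgeConjecture-24832`, h413 = `stmt-HodgeConjecture-24833`) until rung 0
closes; this file asserts no named fact and closes no socket; count-neutral; unconditional.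

## References
* [CasselsFrohlichANT1967] J. Tate, *Global class field theory*, in Cassels–Fröhlich (1967): Ch. VII §5.1, remark after (D) (open subgroups of `C_K` have finite index).
* [WeilBNT1967] A. Weil, *Basic Number Theory* (1967): Ch. IV §4, Thm. 6.
* [MoeglinWaldspurger1995] C. Mœglin, J.-L. Waldspurger, *Spectral Decomposition and Eisenstein Series* (1995): V.3.13 (residual data: `χ = χʷ`).
* [Neukirch1999] J. Neukirch, *Algebraic Number Theory* (1999): Ch. VII §6 (6.1), (6.9).
-/

set_option autoImplicit false
set_option linter.dupNamespace false -- the mandated namespace repeats `HodgeConjecture.HodgeConjecture`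

noncomputable section

open NumberField IsDedekindDomain InfinitePlace
open Literature.NumberTheory.Automorphic Literature.NumberTheory.Automorphic.UnitaryGroup
open Literature.NumberTheory.GaloisRepresentations
open Summit.HodgeConjecture.HodgeConjecture.Cruxes.H413.K2E1IdeleClassCharactersFiniteOfType (finite_setOf_heckeCharacter_arch_eq_level)
open Summit.HodgeConjecture.HodgeConjecture.Cruxes.H413.K2E1CharacterEisensteinU2Defs (reflectChar reflectChar_apply)

namespace Summit.HodgeConjecture.HodgeConjecture.Cruxes.H413.K2E1SelfDualHeckeCharactersFiniteCMTwo

/-! ## §1 Generic: self-dual characters with prescribed torus restriction and level are finitely many, given the square-root property -/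

section Generic

variable {F E : Type} [Field F] [NumberField F] [Field E] [NumberField E] [Algebra F E] (c : E ≃ₐ[F] E)

omit [NumberField F] in
/-- `(c ⊗ 1) a = c • a` on ideles (★ `conjAdele` is the action, ★ `Units.mulDistribMulActionRight`). [folklore] -/
theorem units_map_conjAdele_eq_smul (a : ideleGroup E) :
    Units.map (conjAdele F E c : AdeleRing (𝓞 E) E →+* AdeleRing (𝓞 E) E).toMonoidHom a = c • a :=
  Units.ext rfl

omit [NumberField F] in
/-- **SELF-DUALITY, pointwise**: `χʷ = χ ↔ ∀ a, χ a · χ (c • a) = 1`. [cite: MoeglinWaldspurger1995, V.3.13] -/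
theorem reflectChar_eq_self_iff (χ : HeckeCharacter E) : reflectChar c χ = χ ↔ ∀ a : ideleGroup E, χ a * χ (c • a) = 1 := by
  constructor
  · intro h a
    have ha := DFunLike.congr_fun h a
    rw [reflectChar_apply, units_map_conjAdele_eq_smul] at ha
    rw [← ha, inv_mul_cancel]
  · intro h
    refine DFunLike.ext _ _ fun a => ?_
    rw [reflectChar_apply, units_map_conjAdele_eq_smul]
    exact inv_eq_of_mul_eq_one_left (h a)

omit [NumberField F] in
/-- **FINITELY MANY SELF-DUAL HECKE CHARACTERS OF PRESCRIBED TORUS RESTRICTION AND LEVEL** (generic `E∕F`, `c ∈ Aut(E∕F)`), HYPOTHESIS-FIRST on the square-root property of an arch set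
`Kinf ⊆ E_∞ˣ`: «every `a ∈ E_∞ˣ` is `k · q · q` with `k ∈ Kinf` and `ι_∞ q` FIXED by `c`» (for `E` CM, `c` complex conjugation and `Kinf = {y ȳ = 1}`: §2).  Then for every `Φ` and every
OPEN `U_f`, `{χ | χʷ = χ ∧ (∀ k ∈ Kinf, χ(ι_∞ k) = Φ k) ∧ χ = 1 on the `U_f`-level ideles}` is FINITE: for `χ, χ₀` in the set, `ψ = χ χ₀⁻¹` is self-dual with `ψ(ι_∞ q)² = 1` at fixed `q`,
so `ψ ∘ ι_∞ = 1`, and ★ `finite_setOf_heckeCharacter_arch_eq_level` applies. [cite: CasselsFrohlichANT1967, Ch. VII §5.1, remark after (D)] [cite: MoeglinWaldspurger1995, V.3.13] -/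
theorem finite_setOf_heckeCharacter_selfDual_arch_level (Kinf : Set (InfiniteAdeleRing E)ˣ)
    (hsq : ∀ a : (InfiniteAdeleRing E)ˣ, ∃ k ∈ Kinf, ∃ q : (InfiniteAdeleRing E)ˣ, c • infiniteIdeles E q = infiniteIdeles E q ∧ a = k * q * q)
    (Φ : (InfiniteAdeleRing E)ˣ → ℂˣ) (Uf : Subgroup (FiniteAdeleRing (𝓞 E) E)ˣ) (hUf : IsOpen (Uf : Set (FiniteAdeleRing (𝓞 E) E)ˣ)) :
    {χ : HeckeCharacter E | reflectChar c χ = χ ∧ (∀ k ∈ Kinf, χ (infiniteIdeles E k) = Φ k) ∧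
      ∀ x : ideleGroup E, ((x : ideleGroup E) : AdeleRing (𝓞 E) E).1 = 1 → ideleGroup.finPart E x ∈ Uf → χ x = 1}.Finite := by
  rcases Set.eq_empty_or_nonempty {χ : HeckeCharacter E | reflectChar c χ = χ ∧ (∀ k ∈ Kinf, χ (infiniteIdeles E k) = Φ k) ∧
      ∀ x : ideleGroup E, ((x : ideleGroup E) : AdeleRing (𝓞 E) E).1 = 1 → ideleGroup.finPart E x ∈ Uf → χ x = 1} with h0 | ⟨χ₀, hχ₀⟩
  · rw [h0]
    exact Set.finite_empty
  obtain ⟨hsd₀, harch₀, hlev₀⟩ := hχ₀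
  -- the target finite set: trivial archimedean component, level `U_f`
  have hfin := finite_setOf_heckeCharacter_arch_eq_level (K := E) (fun _ => 1) Uf hUf
  refine Set.Finite.of_finite_image (hfin.subset ?_) (f := fun χ => χ * χ₀⁻¹) ?_
  · rintro _ ⟨χ, ⟨hsd, harch, hlev⟩, rfl⟩
    have hsdψ : ∀ a : ideleGroup E, (χ * χ₀⁻¹) a * (χ * χ₀⁻¹) (c • a) = 1 := by
      intro a
      have h1 := (reflectChar_eq_self_iff c χ).1 hsd a
      have h2 := (reflectChar_eq_self_iff c χ₀).1 hsd₀ a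
      simp only [HeckeCharacter.mul_apply, HeckeCharacter.inv_apply]
      calc χ a * (χ₀ a)⁻¹ * (χ (c • a) * (χ₀ (c • a))⁻¹) = (χ a * χ (c • a)) * (χ₀ a * χ₀ (c • a))⁻¹ := by
            rw [mul_inv]; simp only [mul_assoc, mul_left_comm]
        _ = 1 := by rw [h1, h2, inv_one, mul_one]
    refine ⟨fun a => ?_, fun x hx1 hxf => ?_⟩
    · -- trivial archimedean component: `a = k q q`, `ψ(ι k) = 1`, `ψ(ι q)² = 1`
      obtain ⟨k, hk, q, hq, rfl⟩ := hsq a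
      have hkψ : (χ * χ₀⁻¹) (infiniteIdeles E k) = 1 := by
        rw [HeckeCharacter.mul_apply, HeckeCharacter.inv_apply, harch k hk, harch₀ k hk, mul_inv_cancel]
      have hqψ : (χ * χ₀⁻¹) (infiniteIdeles E q) * (χ * χ₀⁻¹) (infiniteIdeles E q) = 1 := by
        have h := hsdψ (infiniteIdeles E q)
        rwa [hq] at h
      show (χ * χ₀⁻¹) (infiniteIdeles E (k * q * q)) = 1
      rw [map_mul, map_mul, map_mul, map_mul, hkψ, one_mul, hqψ]
    · rw [HeckeCharacter.mul_apply, HeckeCharacter.inv_apply, hlev x hx1 hxf, hlev₀ x hx1 hxf, mul_inv_cancel]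
  · intro χ _ ψ _ h
    exact mul_right_cancel (a := χ) (b := χ₀⁻¹) (c := ψ) h

end Generic

/-! ## §2 CM: every archimedean idele is `k · q²` with `k ȳ-unitary` (`k k̄ = 1`) and `q` positive real (fixed by complex conjugation) -/

section CM

variable (L : Type) [Field L] [NumberField L] [IsCMField L]

/-- **THE SQUARE-ROOT PROPERTY FOR A CM FIELD**: every `a ∈ L_∞ˣ` is `a = k · q · q` with `k ∈ relNormOneInfUnits L⁺ L` (`k k̄ = 1`, i.e. `k ∈ ∏_w U(1)`) and `q` POSITIVE REAL — `ι_w(q_w) = √‖a_w‖`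
for every (complex) place `w` — hence fixed by complex conjugation: `c • ι_∞ q = ι_∞ q`. [cite: WeilBNT1967, Ch. IV §4 Thm. 6] [cite: Neukirch1999, Ch. VII §6 (6.9)] -/
theorem exists_torus_mul_sq_fixed (a : (InfiniteAdeleRing L)ˣ) :
    ∃ k ∈ (relNormOneInfUnits (maximalRealSubfield L) L : Set (InfiniteAdeleRing L)ˣ), ∃ q : (InfiniteAdeleRing L)ˣ,
      IsCMField.complexConj L • infiniteIdeles L q = infiniteIdeles L q ∧ a = k * q * q := by
  -- the positive real square root `q`
  have hρ : ∀ w : InfinitePlace L, ∃ ρ : w.Completion, Completion.extensionEmbedding w ρ = (Real.sqrt ‖(a : InfiniteAdeleRing L) w‖ : ℝ) :=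
    fun w => ArchHerbrand.exists_extensionEmbedding_eq_ofReal w _
  choose ρ hρ using hρ
  have hpos : ∀ w, 0 < ‖(a : InfiniteAdeleRing L) w‖ := fun w => norm_pos_iff.mpr (ArchHerbrand.apply_ne_zero a w)
  have hsqrt : ∀ w, 0 < Real.sqrt ‖(a : InfiniteAdeleRing L) w‖ := fun w => Real.sqrt_pos.2 (hpos w)
  have hρ0 : ∀ w, ρ w ≠ 0 := fun w h0 => by
    have := hρ w
    rw [h0, map_zero] at this
    exact (hsqrt w).ne' (by exact_mod_cast this.symm)
  have hρu : IsUnit (fun w => ρ w : InfiniteAdeleRing L) := Pi.isUnit_iff.mpr fun w => isUnit_iff_ne_zero.mpr (hρ0 w)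
  set q : (InfiniteAdeleRing L)ˣ := hρu.unit with hqdef
  have hqval : ∀ w, (q : InfiniteAdeleRing L) w = ρ w := fun w => by rw [hqdef, IsUnit.unit_spec]
  -- `c • q = q` (complex conjugation fixes the real `√‖a_w‖`)
  have hcq : IsCMField.complexConj L • q = q := by
    have h : HeckeCharacter.infSMul q = q := by
      refine Units.ext (funext fun w => (Completion.extensionEmbedding w).injective ?_)
      rw [HeckeCharacter.extensionEmbedding_infSMul, hqval, hρ, Complex.conj_ofReal]
    exact (Units.ext rfl : IsCMField.complexConj L • q = HeckeCharacter.infSMul q).trans h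
  refine ⟨a * (q * q)⁻¹, ?_, q, ?_, by rw [mul_assoc (a * (q * q)⁻¹) q q, inv_mul_cancel_right]⟩
  · -- `k = a / q²` lies on the torus: `ι_w(k_w) = z∕|z|`, so `k_w · conj k_w = 1`
    rw [SetLike.mem_coe, mem_relNormOneInfUnits_iff_mul_conj]
    have hk : HeckeCharacter.infSMul (a * (q * q)⁻¹) = IsCMField.complexConj L • (a * (q * q)⁻¹) := Units.ext rfl
    rw [← hk]
    refine Units.ext (funext fun w => (Completion.extensionEmbedding w).injective ?_)
    have ht : Completion.extensionEmbedding w (((a * (q * q)⁻¹ : (InfiniteAdeleRing L)ˣ) : InfiniteAdeleRing L) w) =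
        Completion.extensionEmbedding w ((a : InfiniteAdeleRing L) w) *
          (((Real.sqrt ‖(a : InfiniteAdeleRing L) w‖ : ℝ) : ℂ) * ((Real.sqrt ‖(a : InfiniteAdeleRing L) w‖ : ℝ) : ℂ))⁻¹ := by
      rw [Units.val_mul, ArchHerbrand.mul_apply', ArchHerbrand.inv_apply, Units.val_mul, ArchHerbrand.mul_apply', hqval, map_mul, map_inv₀, map_mul, hρ]
    have hnorm : ‖Completion.extensionEmbedding w (((a * (q * q)⁻¹ : (InfiniteAdeleRing L)ˣ) : InfiniteAdeleRing L) w)‖ = 1 := by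
      rw [ht, norm_mul, norm_inv, norm_mul, Complex.norm_real, Real.norm_eq_abs, abs_of_pos (hsqrt w), Real.mul_self_sqrt (hpos w).le,
        ArchHerbrand.norm_extensionEmbedding, mul_inv_cancel₀ (hpos w).ne']
    rw [Units.val_mul, ArchHerbrand.mul_apply', map_mul, HeckeCharacter.extensionEmbedding_infSMul, Complex.mul_conj', hnorm, Complex.ofReal_one, one_pow,
      Units.val_one, ArchHerbrand.one_apply', map_one]
  · rw [galSmul_infiniteIdeles, hcq]

/-! ## §3 THE CM PRINT (C8 = (FIN)) -/

/-- **C8 (FIN): FOR A CM FIELD `L` ONLY FINITELY MANY SELF-DUAL HECKE CHARACTERS HAVE A GIVEN LEVEL AND A GIVEN RESTRICTION TO THE COMPACT ARCHIMEDEAN TORUS.**  `c` = complex conjugation,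
`U_f ≤ (𝔸_L^∞)ˣ` OPEN (a level), `Φ` ANY function on `K_∞^T = relNormOneInfUnits L⁺ L = {y : y ȳ = 1} ≅ ∏_w U(1)` (e.g. `Φ(k) = ∏_w ι_w(k_w)^{m_w}`, fixed circle exponents `m_w`): the set of Hecke
characters `χ` with (i) `χʷ = χ` (`reflectChar c χ = χ`, i.e. `χ(a) χ(c a) = 1`), (ii) `χ x = 1` whenever `x_∞ = 1` and `x_f ∈ U_f`, (iii) `χ(ι_∞ k) = Φ k` for `k ∈ K_∞^T`, is FINITE (§1 + §2; unitarity not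
needed). [cite: CasselsFrohlichANT1967, Ch. VII §5.1, remark after (D)] [cite: WeilBNT1967, Ch. IV §4 Thm. 6] [cite: MoeglinWaldspurger1995, V.3.13] -/
theorem finite_setOf_selfDual_heckeCharacter_cm (Φ : (InfiniteAdeleRing L)ˣ → ℂˣ)
    (Uf : Subgroup (FiniteAdeleRing (𝓞 L) L)ˣ) (hUf : IsOpen (Uf : Set (FiniteAdeleRing (𝓞 L) L)ˣ)) :
    {χ : HeckeCharacter L | reflectChar (IsCMField.complexConj L) χ = χ ∧
      (∀ k ∈ relNormOneInfUnits (maximalRealSubfield L) L, χ (infiniteIdeles L k) = Φ k) ∧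
      ∀ x : ideleGroup L, ((x : ideleGroup L) : AdeleRing (𝓞 L) L).1 = 1 → ideleGroup.finPart L x ∈ Uf → χ x = 1}.Finite :=
  finite_setOf_heckeCharacter_selfDual_arch_level (IsCMField.complexConj L) (relNormOneInfUnits (maximalRealSubfield L) L : Set (InfiniteAdeleRing L)ˣ)
    (fun a => exists_torus_mul_sq_fixed L a) Φ Uf hUf

end CM

end Summit.HodgeConjecture.HodgeConjecture.Cruxes.H413.K2E1SelfDualHeckeCharactersFiniteCMTwo

end
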